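import Summits.Ventures.HSemireg.WeilFrameRealCarrierAllDegrees
import Summits.Ventures.HSemireg.WeilFrameLeadingTerm
import Summits.Ventures.HSemireg.WeilFrameLeadingTermUpper
import Summits.Ventures.HSemireg.WeilFrameLeadingTermMiddle
import Summits.Ventures.HSemireg.WeilFrameLeadingTermPins
import Summits.Ventures.HSemireg.WeilFrameEightfoldPins

/-!
# Venture HSemireg — THE EULER PIN VALUE OF THE EIGHTFOLD `ch(O_Z)`-SHAPE ROW ON THE REAL CARRIER:
# `Σ_{k=0}^{8} (−1)^k dim S_k(x) = 50` off the pins, `49` at `36q₄²`, `48 ∕ 49` at `16q₄²` and at `q₄²` by the two tail criteria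

HONEST FRAMING. Part of the Lean index of the computation cell `pub-hsemireg` (seat w3-mod4-1 gen 14, W3 SPECIAL FIBRES;
MOD4-OFFSPLIT §8 (n = 4: «R = (1,16,104,304,480,304,104,16,1), R(−1) = +50 (generic), 48/49 at the locus», THEOREM A₈: «the pin demands
χ(E,E) ∈ {50, 49, 48}») and §13.22–13.27). This file only ADDS UP the lane's degree-wise kernel theorems for `n = 4`; the tree's real
carriers and the Literature's Weil-type layer ONLY: no semiregularity map, no Ext group, no `∫`, no HRR; nothing here says that
HC / HC_CM / HC_AV holds, or that any object is or is not semiregular; no Literature fact is declared; NO definition is introduced.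
Imports: FILES 15 (edge degrees), 33 + 36 (side degrees), 35 (generic middle), 40 (self-dual pin), 44 (the two tail criteria).

WHAT IS PROVED, for `A : AbelianVariety ℂ` of dimension `8` with the Weil-type hypotheses of `finrank_S_weilType_middle` (`n = 4`), the
class `x = Σ_{m ≤ 8} (q_m/m!) ĥ^m + ĉ₊ + ĉ₋` with `q_0 = ⋯ = q_3 = 0`, `q_4 ≠ 0`, ANY `q_5, …, q_8`, and the pin `8!·(ĉ₊ĉ₋) = t·ĥ⁸`;
write `E(x) := Σ_{k=0}^{8} (−1)^k dim S_k(x)` (an integer; the sides contribute `2(1 − 16 + 104 − 304) = −430`):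
* **`eulerSum_four_of_middle`** — `E(x) = dim S_4(x) − 430` (FILES 15, 33, 36: `dim S_0 = dim S_8 = 1`, `dim S_{1,7} = 16`, `dim S_{2,6} = 104`,
  `dim S_{3,5} = 304`);
* **`eulerSum_four_generic`** — `t ∉ {q₄², 16q₄², 36q₄²}` ⇒ `E(x) = 50`; **`eulerSum_four_self_dual`** — `t = 36q₄²` ⇒ `E(x) = 49`;
* **`eulerSum_four_pin_one_of_eq ∕ _of_ne`** — `t = 16q₄²`: `E(x) = 48` if `5q₄q₆ = 3q₅²`, else `49`;
* **`eulerSum_four_pin_zero_of_eq ∕ _of_ne`** — `t = q₄²`: `E(x) = 48` if `125q₄³q₈ + 320q₄q₅²q₆ = 96q₅⁴ + 150q₄²q₆² + 200q₄²q₅q₇`, else `49`.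
So THEOREM A₈'s Euler-pin side is a kernel number in every case, read off `ch₄, …, ch₈` and the pin `t`. Everything PROVED, 0 sorry.
References: [BuchweitzFlenner2008HH] Prop. 6.4.4; [vanGeemen1994HodgeAV] 4.9, Lemma 5.2; [BourbakiAlgebre1a3] Ch. III §8, §11 no. 9.
-/

noncomputable section

open CliffordAlgebra (contractLeft)
open ExteriorAlgebra (ι)
open Module CategoryTheory
open Literature.AlgebraicGeometry.Motives Literature.AlgebraicGeometry.HodgeTheory
open Literature.AlgebraicTopology.SingularHomology

namespace Summit.Ventures.HSemireg.WeilFrame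

open Summit.Ventures.HSemireg.WedgeBridge Summit.Ventures.HSemireg.WeilCarrier Summit.Ventures.HSemireg.Mod4Carrier
open Summit.Ventures.HSemireg.Wedge.Hankel

section RealCarrier

variable {A : AbelianVariety ℂ}

/-- **the alternating sum in terms of the middle entry:** `Σ_{k=0}^{8} (−1)^k dim S_k(x) = dim S_4(x) − 430` for the eightfold
`ch(O_Z)`-shapes (`q_1 = q_2 = q_3 = 0`, `q_4 ≠ 0`; `q_0` free here): edge degrees `1` (FILE 15), sides `16, 104, 304` on both halves (FILES 33, 36).
[cite: BuchweitzFlenner2008HH, Prop. 6.4.4] [cite: vanGeemen1994HodgeAV, 4.9 and Lemma 5.2] -/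
theorem eulerSum_four_of_middle (hA : IsSmoothProjective A.dim A.X) {d : ℕ} (hdim : A.dim = 4 + 4) (hd : 0 < d)
    {φ : A ⟶ A} (hφ : φ ≫ φ = -(d • 𝟙 A)) {P Q : Submodule ℂ (complexBetti A.X 1)}
    (hP : P = Module.End.eigenspace (complexBetti.map φ.hom.hom.hom 1).hom (Complex.I * (Real.sqrt d : ℂ)))
    (hQ : Q = Module.End.eigenspace (complexBetti.map φ.hom.hom.hom 1).hom (-(Complex.I * (Real.sqrt d : ℂ))))
    (hp : finrank ℂ ↥(P ⊓ hodgeOneZero hA) = 4) {h : complexBetti A.X 2}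
    (hh : complexBetti.map φ.hom.hom.hom 2 h = (d : ℂ) • h) (h11 : IsOfHodgeType A.dim A.X 2 1 1 h)
    (hvol : ((⋀[ℂ]^2 (complexBetti A.X 1)).subtype ((abelianVarietyCohomologyExteriorH1_holds.equiv A 2).symm h)) ^ (4 + 4) ≠ 0)
    {cP cQ : complexBetti A.X (2 * 4)} (hcP : cP ∈ weilClassesPlus A φ 4 d) (hcP0 : cP ≠ 0)
    (hcQ : cQ ∈ weilClassesMinus A φ 4 d) (hcQ0 : cQ ≠ 0)
    {q : ℕ → ℂ} (hq1 : q 1 = 0) (hq2 : q 2 = 0) (hq3 : q 3 = 0) (hq4 : q 4 ≠ 0) :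
    (∑ k ∈ Finset.range (4 + 4 + 1), (-1 : ℤ) ^ k * (finrank ℂ ↥(S ℂ (hodgeZeroOne hA) k
        ((∑ m ∈ Finset.range (4 + 4 + 1), (q m * ((m.factorial : ℕ) : ℂ)⁻¹) •
            ((⋀[ℂ]^2 (complexBetti A.X 1)).subtype ((abelianVarietyCohomologyExteriorH1_holds.equiv A 2).symm h)) ^ m) +
          (⋀[ℂ]^(2 * 4) (complexBetti A.X 1)).subtype ((abelianVarietyCohomologyExteriorH1_holds.equiv A (2 * 4)).symm cP) +
          (⋀[ℂ]^(2 * 4) (complexBetti A.X 1)).subtype ((abelianVarietyCohomologyExteriorH1_holds.equiv A (2 * 4)).symm cQ))) : ℤ)) =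
      (finrank ℂ ↥(S ℂ (hodgeZeroOne hA) 4
        ((∑ m ∈ Finset.range (4 + 4 + 1), (q m * ((m.factorial : ℕ) : ℂ)⁻¹) •
            ((⋀[ℂ]^2 (complexBetti A.X 1)).subtype ((abelianVarietyCohomologyExteriorH1_holds.equiv A 2).symm h)) ^ m) +
          (⋀[ℂ]^(2 * 4) (complexBetti A.X 1)).subtype ((abelianVarietyCohomologyExteriorH1_holds.equiv A (2 * 4)).symm cP) +
          (⋀[ℂ]^(2 * 4) (complexBetti A.X 1)).subtype ((abelianVarietyCohomologyExteriorH1_holds.equiv A (2 * 4)).symm cQ))) : ℤ) - 430 := by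
  haveI : Module.Finite ℂ (complexBetti A.X 1) := abelianVarietyCohomologyExteriorH1_holds.finite_one A
  have hq0' : ∀ m, 1 ≤ m → m < 4 → q m = 0 := by
    intro m hm1 hm
    interval_cases m
    · exact hq1
    · exact hq2
    · exact hq3
  have h0 := finrank_S_weilType_zero hA hdim hd hφ hP hQ hp hh h11 hvol hcP hcP0 hcQ hcQ0 (by norm_num) q
  have h8 := finrank_S_weilType_top hA hdim hd hφ hP hQ hp hh h11 hvol hcP hcP0 hcQ hcQ0 (by norm_num) q
  have h1 := finrank_S_leading_deg hA hdim hd hφ hP hQ hp hh h11 hvol hcP hcP0 hcQ hcQ0 hq0' hq4 (m := 1) (by norm_num) (by norm_num)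
  have h2 := finrank_S_leading_deg hA hdim hd hφ hP hQ hp hh h11 hvol hcP hcP0 hcQ hcQ0 hq0' hq4 (m := 2) (by norm_num) (by norm_num)
  have h3 := finrank_S_leading_deg hA hdim hd hφ hP hQ hp hh h11 hvol hcP hcP0 hcQ hcQ0 hq0' hq4 (m := 3) (by norm_num) (by norm_num)
  have h5 := finrank_S_leading_deg_dual hA hdim hd hφ hP hQ hp hh h11 hvol hcP hcP0 hcQ hcQ0 hq0' hq4 (k := 4 + 1) (k' := 3)
    (by norm_num) (by norm_num) (by norm_num)
  have h6 := finrank_S_leading_deg_dual hA hdim hd hφ hP hQ hp hh h11 hvol hcP hcP0 hcQ hcQ0 hq0' hq4 (k := 4 + 2) (k' := 2)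
    (by norm_num) (by norm_num) (by norm_num)
  have h7 := finrank_S_leading_deg_dual hA hdim hd hφ hP hQ hp hh h11 hvol hcP hcP0 hcQ hcQ0 hq0' hq4 (k := 4 + 3) (k' := 1)
    (by norm_num) (by norm_num) (by norm_num)
  have c41 : Nat.choose 4 1 = 4 := by decide
  have c42 : Nat.choose 4 2 = 6 := by decide
  have c43 : Nat.choose 4 3 = 4 := by decide
  have c81 : Nat.choose (4 + 4) 1 = 8 := by decide
  have c82 : Nat.choose (4 + 4) 2 = 28 := by decide
  have c83 : Nat.choose (4 + 4) 3 = 56 := by decide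
  rw [c41, c81] at h1 h7
  rw [c42, c82] at h2 h6
  rw [c43, c83] at h3 h5
  generalize ((∑ m ∈ Finset.range (4 + 4 + 1), (q m * ((m.factorial : ℕ) : ℂ)⁻¹) •
            ((⋀[ℂ]^2 (complexBetti A.X 1)).subtype ((abelianVarietyCohomologyExteriorH1_holds.equiv A 2).symm h)) ^ m) +
          (⋀[ℂ]^(2 * 4) (complexBetti A.X 1)).subtype ((abelianVarietyCohomologyExteriorH1_holds.equiv A (2 * 4)).symm cP) +
          (⋀[ℂ]^(2 * 4) (complexBetti A.X 1)).subtype ((abelianVarietyCohomologyExteriorH1_holds.equiv A (2 * 4)).symm cQ)) = X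
    at h0 h1 h2 h3 h5 h6 h7 h8 ⊢
  simp only [Finset.sum_range_succ, Finset.sum_range_zero]
  rw [h0, h8]
  norm_num
  omega

/-- **off the pins** (`t ≠ C(4,a)² q₄²` for `a ≤ 4`): `Σ_k (−1)^k dim S_k(x) = 50`.
[cite: BuchweitzFlenner2008HH, Prop. 6.4.4] [cite: vanGeemen1994HodgeAV, 4.9 and Lemma 5.2] -/
theorem eulerSum_four_generic (hA : IsSmoothProjective A.dim A.X) {d : ℕ} (hdim : A.dim = 4 + 4) (hd : 0 < d)
    {φ : A ⟶ A} (hφ : φ ≫ φ = -(d • 𝟙 A)) {P Q : Submodule ℂ (complexBetti A.X 1)}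
    (hP : P = Module.End.eigenspace (complexBetti.map φ.hom.hom.hom 1).hom (Complex.I * (Real.sqrt d : ℂ)))
    (hQ : Q = Module.End.eigenspace (complexBetti.map φ.hom.hom.hom 1).hom (-(Complex.I * (Real.sqrt d : ℂ))))
    (hp : finrank ℂ ↥(P ⊓ hodgeOneZero hA) = 4) {h : complexBetti A.X 2}
    (hh : complexBetti.map φ.hom.hom.hom 2 h = (d : ℂ) • h) (h11 : IsOfHodgeType A.dim A.X 2 1 1 h)
    (hvol : ((⋀[ℂ]^2 (complexBetti A.X 1)).subtype ((abelianVarietyCohomologyExteriorH1_holds.equiv A 2).symm h)) ^ (4 + 4) ≠ 0)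
    {cP cQ : complexBetti A.X (2 * 4)} (hcP : cP ∈ weilClassesPlus A φ 4 d) (hcP0 : cP ≠ 0)
    (hcQ : cQ ∈ weilClassesMinus A φ 4 d) (hcQ0 : cQ ≠ 0)
    {q : ℕ → ℂ} (hq0 : q 0 = 0) (hq1 : q 1 = 0) (hq2 : q 2 = 0) (hq3 : q 3 = 0) (hq4 : q 4 ≠ 0) {t : ℂ}
    (ht : (((4 + 4).factorial : ℕ) : ℂ) •
        ((⋀[ℂ]^(2 * 4) (complexBetti A.X 1)).subtype ((abelianVarietyCohomologyExteriorH1_holds.equiv A (2 * 4)).symm cP) *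
          (⋀[ℂ]^(2 * 4) (complexBetti A.X 1)).subtype ((abelianVarietyCohomologyExteriorH1_holds.equiv A (2 * 4)).symm cQ)) =
      t • ((⋀[ℂ]^2 (complexBetti A.X 1)).subtype ((abelianVarietyCohomologyExteriorH1_holds.equiv A 2).symm h)) ^ (4 + 4))
    (hgen : ∀ a, a ≤ 4 → t ≠ (-1 : ℂ) ^ 4 * (((4 : ℕ).choose a : ℂ) * ((4 : ℕ).choose a : ℂ)) * (q 4 * q 4)) :
    (∑ k ∈ Finset.range (4 + 4 + 1), (-1 : ℤ) ^ k * (finrank ℂ ↥(S ℂ (hodgeZeroOne hA) k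
        ((∑ m ∈ Finset.range (4 + 4 + 1), (q m * ((m.factorial : ℕ) : ℂ)⁻¹) •
            ((⋀[ℂ]^2 (complexBetti A.X 1)).subtype ((abelianVarietyCohomologyExteriorH1_holds.equiv A 2).symm h)) ^ m) +
          (⋀[ℂ]^(2 * 4) (complexBetti A.X 1)).subtype ((abelianVarietyCohomologyExteriorH1_holds.equiv A (2 * 4)).symm cP) +
          (⋀[ℂ]^(2 * 4) (complexBetti A.X 1)).subtype ((abelianVarietyCohomologyExteriorH1_holds.equiv A (2 * 4)).symm cQ))) : ℤ)) = 50 := by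
  haveI : Module.Finite ℂ (complexBetti A.X 1) := abelianVarietyCohomologyExteriorH1_holds.finite_one A
  rw [eulerSum_four_of_middle hA hdim hd hφ hP hQ hp hh h11 hvol hcP hcP0 hcQ hcQ0 hq1 hq2 hq3 hq4]
  have hm := finrank_S_leading_middle_generic hA hdim hd hφ hP hQ hp hh h11 hvol hcP hcP0 hcQ hcQ0 (by norm_num)
    (q := q) (by intro m hm; interval_cases m <;> assumption) hq4 ht hgen
  have e : (4 + 4).choose 4 = 70 := by decide
  rw [e] at hm
  omega

/-- **at the self-dual pin** `t = 36q₄²`: `Σ_k (−1)^k dim S_k(x) = 49`.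
[cite: BuchweitzFlenner2008HH, Prop. 6.4.4] [cite: vanGeemen1994HodgeAV, 4.9 and Lemma 5.2] -/
theorem eulerSum_four_self_dual (hA : IsSmoothProjective A.dim A.X) {d : ℕ} (hdim : A.dim = 4 + 4) (hd : 0 < d)
    {φ : A ⟶ A} (hφ : φ ≫ φ = -(d • 𝟙 A)) {P Q : Submodule ℂ (complexBetti A.X 1)}
    (hP : P = Module.End.eigenspace (complexBetti.map φ.hom.hom.hom 1).hom (Complex.I * (Real.sqrt d : ℂ)))
    (hQ : Q = Module.End.eigenspace (complexBetti.map φ.hom.hom.hom 1).hom (-(Complex.I * (Real.sqrt d : ℂ))))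
    (hp : finrank ℂ ↥(P ⊓ hodgeOneZero hA) = 4) {h : complexBetti A.X 2}
    (hh : complexBetti.map φ.hom.hom.hom 2 h = (d : ℂ) • h) (h11 : IsOfHodgeType A.dim A.X 2 1 1 h)
    (hvol : ((⋀[ℂ]^2 (complexBetti A.X 1)).subtype ((abelianVarietyCohomologyExteriorH1_holds.equiv A 2).symm h)) ^ (4 + 4) ≠ 0)
    {cP cQ : complexBetti A.X (2 * 4)} (hcP : cP ∈ weilClassesPlus A φ 4 d) (hcP0 : cP ≠ 0)
    (hcQ : cQ ∈ weilClassesMinus A φ 4 d) (hcQ0 : cQ ≠ 0)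
    {q : ℕ → ℂ} (hq0 : q 0 = 0) (hq1 : q 1 = 0) (hq2 : q 2 = 0) (hq3 : q 3 = 0) (hq4 : q 4 ≠ 0) {t : ℂ}
    (ht : (((4 + 4).factorial : ℕ) : ℂ) •
        ((⋀[ℂ]^(2 * 4) (complexBetti A.X 1)).subtype ((abelianVarietyCohomologyExteriorH1_holds.equiv A (2 * 4)).symm cP) *
          (⋀[ℂ]^(2 * 4) (complexBetti A.X 1)).subtype ((abelianVarietyCohomologyExteriorH1_holds.equiv A (2 * 4)).symm cQ)) =
      t • ((⋀[ℂ]^2 (complexBetti A.X 1)).subtype ((abelianVarietyCohomologyExteriorH1_holds.equiv A 2).symm h)) ^ (4 + 4))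
    (hpin : t = 36 * (q 4 * q 4)) :
    (∑ k ∈ Finset.range (4 + 4 + 1), (-1 : ℤ) ^ k * (finrank ℂ ↥(S ℂ (hodgeZeroOne hA) k
        ((∑ m ∈ Finset.range (4 + 4 + 1), (q m * ((m.factorial : ℕ) : ℂ)⁻¹) •
            ((⋀[ℂ]^2 (complexBetti A.X 1)).subtype ((abelianVarietyCohomologyExteriorH1_holds.equiv A 2).symm h)) ^ m) +
          (⋀[ℂ]^(2 * 4) (complexBetti A.X 1)).subtype ((abelianVarietyCohomologyExteriorH1_holds.equiv A (2 * 4)).symm cP) +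
          (⋀[ℂ]^(2 * 4) (complexBetti A.X 1)).subtype ((abelianVarietyCohomologyExteriorH1_holds.equiv A (2 * 4)).symm cQ))) : ℤ)) = 49 := by
  haveI : Module.Finite ℂ (complexBetti A.X 1) := abelianVarietyCohomologyExteriorH1_holds.finite_one A
  rw [eulerSum_four_of_middle hA hdim hd hφ hP hQ hp hh h11 hvol hcP hcP0 hcQ hcQ0 hq1 hq2 hq3 hq4]
  have hm := finrank_S_leading_middle_self_dual_pin hA hdim hd hφ hP hQ hp hh h11 hvol hcP hcP0 hcQ hcQ0 (by norm_num)
    (q := q) (by intro m hm; interval_cases m <;> assumption) hq4 ht (a := 2) (by norm_num)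
    (by rw [hpin]; norm_num [show Nat.choose 4 2 = 6 from by decide])
  have e : (4 + 4).choose 4 = 70 := by decide
  rw [e] at hm
  omega

/-- **at the pin** `t = 16q₄²` with `5q₄q₆ = 3q₅²`: `Σ_k (−1)^k dim S_k(x) = 48`.
[cite: BuchweitzFlenner2008HH, Prop. 6.4.4] [cite: vanGeemen1994HodgeAV, 4.9 and Lemma 5.2] -/
theorem eulerSum_four_pin_one_of_eq (hA : IsSmoothProjective A.dim A.X) {d : ℕ} (hdim : A.dim = 4 + 4) (hd : 0 < d)
    {φ : A ⟶ A} (hφ : φ ≫ φ = -(d • 𝟙 A)) {P Q : Submodule ℂ (complexBetti A.X 1)}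
    (hP : P = Module.End.eigenspace (complexBetti.map φ.hom.hom.hom 1).hom (Complex.I * (Real.sqrt d : ℂ)))
    (hQ : Q = Module.End.eigenspace (complexBetti.map φ.hom.hom.hom 1).hom (-(Complex.I * (Real.sqrt d : ℂ))))
    (hp : finrank ℂ ↥(P ⊓ hodgeOneZero hA) = 4) {h : complexBetti A.X 2}
    (hh : complexBetti.map φ.hom.hom.hom 2 h = (d : ℂ) • h) (h11 : IsOfHodgeType A.dim A.X 2 1 1 h)
    (hvol : ((⋀[ℂ]^2 (complexBetti A.X 1)).subtype ((abelianVarietyCohomologyExteriorH1_holds.equiv A 2).symm h)) ^ (4 + 4) ≠ 0)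
    {cP cQ : complexBetti A.X (2 * 4)} (hcP : cP ∈ weilClassesPlus A φ 4 d) (hcP0 : cP ≠ 0)
    (hcQ : cQ ∈ weilClassesMinus A φ 4 d) (hcQ0 : cQ ≠ 0)
    {q : ℕ → ℂ} (hq0 : q 0 = 0) (hq1 : q 1 = 0) (hq2 : q 2 = 0) (hq3 : q 3 = 0) (hq4 : q 4 ≠ 0) {t : ℂ}
    (ht : (((4 + 4).factorial : ℕ) : ℂ) •
        ((⋀[ℂ]^(2 * 4) (complexBetti A.X 1)).subtype ((abelianVarietyCohomologyExteriorH1_holds.equiv A (2 * 4)).symm cP) *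
          (⋀[ℂ]^(2 * 4) (complexBetti A.X 1)).subtype ((abelianVarietyCohomologyExteriorH1_holds.equiv A (2 * 4)).symm cQ)) =
      t • ((⋀[ℂ]^2 (complexBetti A.X 1)).subtype ((abelianVarietyCohomologyExteriorH1_holds.equiv A 2).symm h)) ^ (4 + 4))
    (hpin : t = 16 * (q 4 * q 4)) (hc : 5 * q 4 * q 6 = 3 * (q 5 * q 5)) :
    (∑ k ∈ Finset.range (4 + 4 + 1), (-1 : ℤ) ^ k * (finrank ℂ ↥(S ℂ (hodgeZeroOne hA) k
        ((∑ m ∈ Finset.range (4 + 4 + 1), (q m * ((m.factorial : ℕ) : ℂ)⁻¹) •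
            ((⋀[ℂ]^2 (complexBetti A.X 1)).subtype ((abelianVarietyCohomologyExteriorH1_holds.equiv A 2).symm h)) ^ m) +
          (⋀[ℂ]^(2 * 4) (complexBetti A.X 1)).subtype ((abelianVarietyCohomologyExteriorH1_holds.equiv A (2 * 4)).symm cP) +
          (⋀[ℂ]^(2 * 4) (complexBetti A.X 1)).subtype ((abelianVarietyCohomologyExteriorH1_holds.equiv A (2 * 4)).symm cQ))) : ℤ)) = 48 := by
  haveI : Module.Finite ℂ (complexBetti A.X 1) := abelianVarietyCohomologyExteriorH1_holds.finite_one A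
  rw [eulerSum_four_of_middle hA hdim hd hφ hP hQ hp hh h11 hvol hcP hcP0 hcQ hcQ0 hq1 hq2 hq3 hq4]
  have hm := finrank_S_four_pin_one_of_eq hA hdim hd hφ hP hQ hp hh h11 hvol hcP hcP0 hcQ hcQ0 hq0 hq1 hq2 hq3 hq4 ht hpin hc
  omega

/-- **at the pin** `t = 16q₄²` with `5q₄q₆ ≠ 3q₅²`: `Σ_k (−1)^k dim S_k(x) = 49`.
[cite: BuchweitzFlenner2008HH, Prop. 6.4.4] [cite: vanGeemen1994HodgeAV, 4.9 and Lemma 5.2] -/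
theorem eulerSum_four_pin_one_of_ne (hA : IsSmoothProjective A.dim A.X) {d : ℕ} (hdim : A.dim = 4 + 4) (hd : 0 < d)
    {φ : A ⟶ A} (hφ : φ ≫ φ = -(d • 𝟙 A)) {P Q : Submodule ℂ (complexBetti A.X 1)}
    (hP : P = Module.End.eigenspace (complexBetti.map φ.hom.hom.hom 1).hom (Complex.I * (Real.sqrt d : ℂ)))
    (hQ : Q = Module.End.eigenspace (complexBetti.map φ.hom.hom.hom 1).hom (-(Complex.I * (Real.sqrt d : ℂ))))
    (hp : finrank ℂ ↥(P ⊓ hodgeOneZero hA) = 4) {h : complexBetti A.X 2}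
    (hh : complexBetti.map φ.hom.hom.hom 2 h = (d : ℂ) • h) (h11 : IsOfHodgeType A.dim A.X 2 1 1 h)
    (hvol : ((⋀[ℂ]^2 (complexBetti A.X 1)).subtype ((abelianVarietyCohomologyExteriorH1_holds.equiv A 2).symm h)) ^ (4 + 4) ≠ 0)
    {cP cQ : complexBetti A.X (2 * 4)} (hcP : cP ∈ weilClassesPlus A φ 4 d) (hcP0 : cP ≠ 0)
    (hcQ : cQ ∈ weilClassesMinus A φ 4 d) (hcQ0 : cQ ≠ 0)
    {q : ℕ → ℂ} (hq0 : q 0 = 0) (hq1 : q 1 = 0) (hq2 : q 2 = 0) (hq3 : q 3 = 0) (hq4 : q 4 ≠ 0) {t : ℂ}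
    (ht : (((4 + 4).factorial : ℕ) : ℂ) •
        ((⋀[ℂ]^(2 * 4) (complexBetti A.X 1)).subtype ((abelianVarietyCohomologyExteriorH1_holds.equiv A (2 * 4)).symm cP) *
          (⋀[ℂ]^(2 * 4) (complexBetti A.X 1)).subtype ((abelianVarietyCohomologyExteriorH1_holds.equiv A (2 * 4)).symm cQ)) =
      t • ((⋀[ℂ]^2 (complexBetti A.X 1)).subtype ((abelianVarietyCohomologyExteriorH1_holds.equiv A 2).symm h)) ^ (4 + 4))
    (hpin : t = 16 * (q 4 * q 4)) (hc : 5 * q 4 * q 6 ≠ 3 * (q 5 * q 5)) :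
    (∑ k ∈ Finset.range (4 + 4 + 1), (-1 : ℤ) ^ k * (finrank ℂ ↥(S ℂ (hodgeZeroOne hA) k
        ((∑ m ∈ Finset.range (4 + 4 + 1), (q m * ((m.factorial : ℕ) : ℂ)⁻¹) •
            ((⋀[ℂ]^2 (complexBetti A.X 1)).subtype ((abelianVarietyCohomologyExteriorH1_holds.equiv A 2).symm h)) ^ m) +
          (⋀[ℂ]^(2 * 4) (complexBetti A.X 1)).subtype ((abelianVarietyCohomologyExteriorH1_holds.equiv A (2 * 4)).symm cP) +
          (⋀[ℂ]^(2 * 4) (complexBetti A.X 1)).subtype ((abelianVarietyCohomologyExteriorH1_holds.equiv A (2 * 4)).symm cQ))) : ℤ)) = 49 := by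
  haveI : Module.Finite ℂ (complexBetti A.X 1) := abelianVarietyCohomologyExteriorH1_holds.finite_one A
  rw [eulerSum_four_of_middle hA hdim hd hφ hP hQ hp hh h11 hvol hcP hcP0 hcQ hcQ0 hq1 hq2 hq3 hq4]
  have hm := finrank_S_four_pin_one_of_ne hA hdim hd hφ hP hQ hp hh h11 hvol hcP hcP0 hcQ hcQ0 hq0 hq1 hq2 hq3 hq4 ht hpin hc
  omega

/-- **at the pin** `t = q₄²` with the weight-20 quartic vanishing: `Σ_k (−1)^k dim S_k(x) = 48`.
[cite: BuchweitzFlenner2008HH, Prop. 6.4.4] [cite: vanGeemen1994HodgeAV, 4.9 and Lemma 5.2] -/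
theorem eulerSum_four_pin_zero_of_eq (hA : IsSmoothProjective A.dim A.X) {d : ℕ} (hdim : A.dim = 4 + 4) (hd : 0 < d)
    {φ : A ⟶ A} (hφ : φ ≫ φ = -(d • 𝟙 A)) {P Q : Submodule ℂ (complexBetti A.X 1)}
    (hP : P = Module.End.eigenspace (complexBetti.map φ.hom.hom.hom 1).hom (Complex.I * (Real.sqrt d : ℂ)))
    (hQ : Q = Module.End.eigenspace (complexBetti.map φ.hom.hom.hom 1).hom (-(Complex.I * (Real.sqrt d : ℂ))))
    (hp : finrank ℂ ↥(P ⊓ hodgeOneZero hA) = 4) {h : complexBetti A.X 2}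
    (hh : complexBetti.map φ.hom.hom.hom 2 h = (d : ℂ) • h) (h11 : IsOfHodgeType A.dim A.X 2 1 1 h)
    (hvol : ((⋀[ℂ]^2 (complexBetti A.X 1)).subtype ((abelianVarietyCohomologyExteriorH1_holds.equiv A 2).symm h)) ^ (4 + 4) ≠ 0)
    {cP cQ : complexBetti A.X (2 * 4)} (hcP : cP ∈ weilClassesPlus A φ 4 d) (hcP0 : cP ≠ 0)
    (hcQ : cQ ∈ weilClassesMinus A φ 4 d) (hcQ0 : cQ ≠ 0)
    {q : ℕ → ℂ} (hq0 : q 0 = 0) (hq1 : q 1 = 0) (hq2 : q 2 = 0) (hq3 : q 3 = 0) (hq4 : q 4 ≠ 0) {t : ℂ}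
    (ht : (((4 + 4).factorial : ℕ) : ℂ) •
        ((⋀[ℂ]^(2 * 4) (complexBetti A.X 1)).subtype ((abelianVarietyCohomologyExteriorH1_holds.equiv A (2 * 4)).symm cP) *
          (⋀[ℂ]^(2 * 4) (complexBetti A.X 1)).subtype ((abelianVarietyCohomologyExteriorH1_holds.equiv A (2 * 4)).symm cQ)) =
      t • ((⋀[ℂ]^2 (complexBetti A.X 1)).subtype ((abelianVarietyCohomologyExteriorH1_holds.equiv A 2).symm h)) ^ (4 + 4))
    (hpin : t = q 4 * q 4) (hc : 125 * q 4 ^ 3 * q 8 + 320 * q 4 * q 5 ^ 2 * q 6 = 96 * q 5 ^ 4 + 150 * q 4 ^ 2 * q 6 ^ 2 + 200 * q 4 ^ 2 * q 5 * q 7) :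
    (∑ k ∈ Finset.range (4 + 4 + 1), (-1 : ℤ) ^ k * (finrank ℂ ↥(S ℂ (hodgeZeroOne hA) k
        ((∑ m ∈ Finset.range (4 + 4 + 1), (q m * ((m.factorial : ℕ) : ℂ)⁻¹) •
            ((⋀[ℂ]^2 (complexBetti A.X 1)).subtype ((abelianVarietyCohomologyExteriorH1_holds.equiv A 2).symm h)) ^ m) +
          (⋀[ℂ]^(2 * 4) (complexBetti A.X 1)).subtype ((abelianVarietyCohomologyExteriorH1_holds.equiv A (2 * 4)).symm cP) +
          (⋀[ℂ]^(2 * 4) (complexBetti A.X 1)).subtype ((abelianVarietyCohomologyExteriorH1_holds.equiv A (2 * 4)).symm cQ))) : ℤ)) = 48 := by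
  haveI : Module.Finite ℂ (complexBetti A.X 1) := abelianVarietyCohomologyExteriorH1_holds.finite_one A
  rw [eulerSum_four_of_middle hA hdim hd hφ hP hQ hp hh h11 hvol hcP hcP0 hcQ hcQ0 hq1 hq2 hq3 hq4]
  have hm := finrank_S_four_pin_zero_of_eq hA hdim hd hφ hP hQ hp hh h11 hvol hcP hcP0 hcQ hcQ0 hq0 hq1 hq2 hq3 hq4 ht hpin hc
  omega

/-- **at the pin** `t = q₄²` with the weight-20 quartic non-vanishing: `Σ_k (−1)^k dim S_k(x) = 49`.
[cite: BuchweitzFlenner2008HH, Prop. 6.4.4] [cite: vanGeemen1994HodgeAV, 4.9 and Lemma 5.2] -/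
theorem eulerSum_four_pin_zero_of_ne (hA : IsSmoothProjective A.dim A.X) {d : ℕ} (hdim : A.dim = 4 + 4) (hd : 0 < d)
    {φ : A ⟶ A} (hφ : φ ≫ φ = -(d • 𝟙 A)) {P Q : Submodule ℂ (complexBetti A.X 1)}
    (hP : P = Module.End.eigenspace (complexBetti.map φ.hom.hom.hom 1).hom (Complex.I * (Real.sqrt d : ℂ)))
    (hQ : Q = Module.End.eigenspace (complexBetti.map φ.hom.hom.hom 1).hom (-(Complex.I * (Real.sqrt d : ℂ))))
    (hp : finrank ℂ ↥(P ⊓ hodgeOneZero hA) = 4) {h : complexBetti A.X 2}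
    (hh : complexBetti.map φ.hom.hom.hom 2 h = (d : ℂ) • h) (h11 : IsOfHodgeType A.dim A.X 2 1 1 h)
    (hvol : ((⋀[ℂ]^2 (complexBetti A.X 1)).subtype ((abelianVarietyCohomologyExteriorH1_holds.equiv A 2).symm h)) ^ (4 + 4) ≠ 0)
    {cP cQ : complexBetti A.X (2 * 4)} (hcP : cP ∈ weilClassesPlus A φ 4 d) (hcP0 : cP ≠ 0)
    (hcQ : cQ ∈ weilClassesMinus A φ 4 d) (hcQ0 : cQ ≠ 0)
    {q : ℕ → ℂ} (hq0 : q 0 = 0) (hq1 : q 1 = 0) (hq2 : q 2 = 0) (hq3 : q 3 = 0) (hq4 : q 4 ≠ 0) {t : ℂ}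
    (ht : (((4 + 4).factorial : ℕ) : ℂ) •
        ((⋀[ℂ]^(2 * 4) (complexBetti A.X 1)).subtype ((abelianVarietyCohomologyExteriorH1_holds.equiv A (2 * 4)).symm cP) *
          (⋀[ℂ]^(2 * 4) (complexBetti A.X 1)).subtype ((abelianVarietyCohomologyExteriorH1_holds.equiv A (2 * 4)).symm cQ)) =
      t • ((⋀[ℂ]^2 (complexBetti A.X 1)).subtype ((abelianVarietyCohomologyExteriorH1_holds.equiv A 2).symm h)) ^ (4 + 4))
    (hpin : t = q 4 * q 4) (hc : 125 * q 4 ^ 3 * q 8 + 320 * q 4 * q 5 ^ 2 * q 6 ≠ 96 * q 5 ^ 4 + 150 * q 4 ^ 2 * q 6 ^ 2 + 200 * q 4 ^ 2 * q 5 * q 7) :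
    (∑ k ∈ Finset.range (4 + 4 + 1), (-1 : ℤ) ^ k * (finrank ℂ ↥(S ℂ (hodgeZeroOne hA) k
        ((∑ m ∈ Finset.range (4 + 4 + 1), (q m * ((m.factorial : ℕ) : ℂ)⁻¹) •
            ((⋀[ℂ]^2 (complexBetti A.X 1)).subtype ((abelianVarietyCohomologyExteriorH1_holds.equiv A 2).symm h)) ^ m) +
          (⋀[ℂ]^(2 * 4) (complexBetti A.X 1)).subtype ((abelianVarietyCohomologyExteriorH1_holds.equiv A (2 * 4)).symm cP) +
          (⋀[ℂ]^(2 * 4) (complexBetti A.X 1)).subtype ((abelianVarietyCohomologyExteriorH1_holds.equiv A (2 * 4)).symm cQ))) : ℤ)) = 49 := by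
  haveI : Module.Finite ℂ (complexBetti A.X 1) := abelianVarietyCohomologyExteriorH1_holds.finite_one A
  rw [eulerSum_four_of_middle hA hdim hd hφ hP hQ hp hh h11 hvol hcP hcP0 hcQ hcQ0 hq1 hq2 hq3 hq4]
  have hm := finrank_S_four_pin_zero_of_ne hA hdim hd hφ hP hQ hp hh h11 hvol hcP hcP0 hcQ hcQ0 hq0 hq1 hq2 hq3 hq4 ht hpin hc
  omega

end RealCarrier

end Summit.Ventures.HSemireg.WeilFrame

end
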